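import Mathlib
import Summits.ValiantsHypothesis.ValiantsHypothesis.Theorems.KPlusLogSqLawWeakLiftingTowerGraftSkewBlockBidiagonal

/-!
# Tower graft line — THE BIDIAGONAL SKEW-BLOCK FAMILY ON GENUINE TOWERS: `2m` phantoms with rootless digits at three letters, every size

Calibration file for the line `Cruxes/WeakLifting/Lines/tower_graft.lean` (crux `WeakLifting` = stmt-ValiantsHypothesis-19561; S4b; crit-6 kill-shape
#38⁺).  NO stub is claimed.  Tower-respecting version of `…SkewBlockBidiagonal` (support there fixed at `(1,5,21)`): here, for `m = 2(q+1)`, the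
support is the genuine `m`-TOWER `d = (1, 1 + m, 1 + (m+1)·m)` and the corner sits at the tower-top exponent `D = m·(1 + (m+1)m) + 1` — exactly the
hypotheses of the line's S4b (`IsTower m d`, `m·dₗ < D`).
* `trinomial_division` — for `n ≥ 2`, `a, b > 0`: `u^n − h₁u + ab·h₂ = (u − a)(u − b)·H(u)` with `h₂ > 0`, `a·h₂ ≤ h₁`, `H > 0` on `[0,∞)`
  (the complete-homogeneous recursion `h' = (a+b)h₁ − ab h₂`, `H'(u) = u·H(u) + h₁`; existential, def-free). [folklore]
* `skewBlock_phantoms_bidiag_tower (q)` — **for every `q` (m = 2(q+1)): three-letter blocks `B` (upper bidiagonal, superdiagonal `t`, diagonal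
  `t·(u^{m+1} − h₁u + A_rB_rh₂)` in `u = t^m` with `A_r = (2r+1)^m`, `B_r = (2r+2)^m`, i.e. roots exactly `t = 2r+1, 2r+2`) and an `η > 0` such that
  on the `m`-tower above, the symmetric skew-block pencil of size `m` has a corner graft with at least `4(q+1) = 2m` distinct positive roots while
  BOTH digits are rootless; the tower inequalities are part of the conclusion.**
READING: on genuine towers, at `K = 3`, with rootless digits, the phantom count grows linearly in `m` ⇒ no corner law `Z₊(h) ≤ Z₊(A) + Z₊(E) + f(K)`
holds for ANY `f` (kernel; #38 = the case `f ≡ c`); the class floor `(m+1)(K−1) = 2(m+1) > 2m` is NOT beaten by this family — beating it needs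
Descartes-rich `B` (`≈ m²/4` roots), which stays LOCATED (`exp/skewblock_k3.py`).  S4b untouched.
HONEST FRAMING: explicit algebra feeding p689545's mechanism; nothing on S4/S4b/S5/S5ᴸ, TowerB, `WeakLifting`, Conjecture B, `MatrixDescartes` (18050) or
`VP ≠ VNP`.  Def-free.  Seat: prover val-sym-lift-p2 g19, `--supports stmt-ValiantsHypothesis-19561`.
-/

-- `Summit.ValiantsHypothesis.ValiantsHypothesis.…` repeats a component by the D-0017 layout
-- (single-conjunct summit), which the `dupNamespace` linter flags; the name is mandated.
set_option linter.dupNamespace false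

namespace Summit.ValiantsHypothesis.ValiantsHypothesis.Theorems.KPlusLogSqLaw.TowerGraft

open Polynomial Matrix
open scoped BigOperators Polynomial

section BidiagonalTower

/-- **trinomial division**: for `n ≥ 2` and `a, b > 0` there are `h₁ ≥ a·h₂ > 0` and a function `H`, positive on `[0,∞)`, with
`u^n − h₁ u + a b h₂ = (u − a)(u − b)·H(u)` (the `h`'s are complete homogeneous symmetric polynomials of `a, b`). [folklore] -/
theorem trinomial_division (a b : ℝ) (ha : 0 < a) (hb : 0 < b) :
    ∀ n : ℕ, 2 ≤ n → ∃ h₁ h₂ : ℝ, 0 < h₂ ∧ a * h₂ ≤ h₁ ∧ ∃ H : ℝ → ℝ, (∀ u, 0 ≤ u → 0 < H u) ∧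
      ∀ u, u ^ n - h₁ * u + a * b * h₂ = (u - a) * (u - b) * H u := by
  intro n hn
  induction n with
  | zero => omega
  | succ n ih =>
    rcases Nat.lt_or_ge n 2 with hlt | hge
    · -- `n + 1 = 2`
      have hn2 : n = 1 := by omega
      subst hn2
      refine ⟨a + b, 1, one_pos, by linarith, fun _ => 1, fun _ _ => one_pos, fun u => by ring⟩
    · obtain ⟨h₁, h₂, hh₂, hle, H, hH, hid⟩ := ih hge
      have hh₁ : 0 < h₁ := lt_of_lt_of_le (mul_pos ha hh₂) hle
      refine ⟨(a + b) * h₁ - a * b * h₂, h₁, hh₁, ?_, fun u => u * H u + h₁, fun u hu => ?_, fun u => ?_⟩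
      · nlinarith [mul_le_mul_of_nonneg_left hle hb.le]
      · have := hH u hu; positivity
      · have e := hid u
        calc u ^ (n + 1) - ((a + b) * h₁ - a * b * h₂) * u + a * b * h₁
            = u * (u ^ n - h₁ * u + a * b * h₂) + h₁ * (u ^ 2 - (a + b) * u + a * b) := by ring
          _ = u * ((u - a) * (u - b) * H u) + h₁ * (u ^ 2 - (a + b) * u + a * b) := by rw [e]
          _ = (u - a) * (u - b) * (u * H u + h₁) := by ring

/-- `(n + 1/2)^m ≠ k^m` for naturals `n, k` and `m ≠ 0`. [folklore] -/
theorem nat_add_half_pow_ne (n k m : ℕ) (hm : m ≠ 0) : ((n : ℝ) + 1 / 2) ^ m ≠ ((k : ℕ) : ℝ) ^ m := by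
  intro h
  have h1 : (0 : ℝ) ≤ (n : ℝ) + 1 / 2 := by positivity
  have h2 : (0 : ℝ) ≤ (k : ℝ) := by positivity
  exact nat_add_half_ne_nat n k ((pow_left_inj₀ h1 h2 hm).mp h)


/-- **THE BIDIAGONAL SKEW-BLOCK FAMILY ON GENUINE TOWERS (kernel, every size).**  For every `q`, with `m = 2(q+1)`: on the `m`-TOWER
`d = (1, 1 + m, 1 + (m+1)·m)` (`m·dₗ < dₗ₊₁`), with the corner at the tower-top exponent `D = m·(1 + (m+1)m) + 1`, there are three-letter blocks `B`
(upper bidiagonal: superdiagonal `t`, diagonal `t·(u^{m+1} − h₁u + A_rB_rh₂)` in `u = t^m`, vanishing exactly at `t = 2r+1, 2r+2`) and an `η > 0`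
such that the symmetric skew-block pencil of size `m` has a corner graft with **at least `2m = 4(q+1)` distinct positive roots while BOTH digits
are rootless**.  ⇒ on towers, at three letters, no corner law `Z₊(h) ≤ Z₊(A) + Z₊(E) + f(K)` survives for any `f` (kernel strengthening of #38);
the class FLOOR `(m+1)(K−1) = 2(m+1)` is NOT beaten by this family (that needs Descartes-rich `B`, located). [this work] -/
theorem skewBlock_phantoms_bidiag_tower (q : ℕ) :
    ∃ (B : Fin 3 → Matrix (Fin (q + 1)) (Fin (q + 1)) ℝ) (η : ℝ), 0 < η ∧
      (∀ l l' : Fin 3, l < l' → 2 * (q + 1) * (![1, 1 + 2 * (q + 1), 1 + (2 * (q + 1) + 1) * (2 * (q + 1))] : Fin 3 → ℕ) l <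
        (![1, 1 + 2 * (q + 1), 1 + (2 * (q + 1) + 1) * (2 * (q + 1))] : Fin 3 → ℕ) l') ∧
      (∀ l : Fin 3, 2 * (q + 1) * (![1, 1 + 2 * (q + 1), 1 + (2 * (q + 1) + 1) * (2 * (q + 1))] : Fin 3 → ℕ) l <
        2 * (q + 1) * (1 + (2 * (q + 1) + 1) * (2 * (q + 1))) + 1) ∧
      ((∑ l, (X : ℝ[X]) ^ (![1, 1 + 2 * (q + 1), 1 + (2 * (q + 1) + 1) * (2 * (q + 1))] : Fin 3 → ℕ) l •
        (Matrix.fromBlocks (if l = 0 then η • (1 : Matrix (Fin (q + 1)) (Fin (q + 1)) ℝ) else 0)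
        (B l) (B l)ᵀ (if l = 0 then -(η • (1 : Matrix (Fin (q + 1)) (Fin (q + 1)) ℝ)) else 0)).map C).det.roots.toFinset.filter
        (fun t => 0 < t)).card = 0 ∧
      (((∑ l, (X : ℝ[X]) ^ (![1, 1 + 2 * (q + 1), 1 + (2 * (q + 1) + 1) * (2 * (q + 1))] : Fin 3 → ℕ) l •
        (Matrix.fromBlocks (if l = 0 then η • (1 : Matrix (Fin (q + 1)) (Fin (q + 1)) ℝ) else 0)
        (B l) (B l)ᵀ (if l = 0 then -(η • (1 : Matrix (Fin (q + 1)) (Fin (q + 1)) ℝ)) else 0)).map C).submatrix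
        (Sum.map id (0 : Fin (q + 1)).succAbove) (Sum.map id (0 : Fin (q + 1)).succAbove)).det.roots.toFinset.filter
        (fun t => 0 < t)).card = 0 ∧
      4 * (q + 1) ≤ ((((∑ l, (X : ℝ[X]) ^ (![1, 1 + 2 * (q + 1), 1 + (2 * (q + 1) + 1) * (2 * (q + 1))] : Fin 3 → ℕ) l •
          (Matrix.fromBlocks (if l = 0 then η • (1 : Matrix (Fin (q + 1)) (Fin (q + 1)) ℝ) else 0) (B l) (B l)ᵀ
          (if l = 0 then -(η • (1 : Matrix (Fin (q + 1)) (Fin (q + 1)) ℝ)) else 0)).map C) +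
        (X : ℝ[X]) ^ (2 * (q + 1) * (1 + (2 * (q + 1) + 1) * (2 * (q + 1))) + 1) •
          Matrix.single (Sum.inr 0 : Fin (q + 1) ⊕ Fin (q + 1)) (Sum.inr 0) (1 : ℝ[X])).det).roots.toFinset.filter
        (fun t => 0 < t)).card := by
  obtain ⟨m, hm⟩ : ∃ m : ℕ, m = 2 * (q + 1) := ⟨_, rfl⟩
  obtain ⟨n, hn⟩ : ∃ n : ℕ, n = m + 1 := ⟨_, rfl⟩
  have hm2 : 2 ≤ m := by omega
  have hm0 : m ≠ 0 := by omega
  -- block root data in `u = t^m`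
  set Ar : Fin (q + 1) → ℝ := fun r => ((2 * (r : ℕ) + 1 : ℕ) : ℝ) ^ m with hAr
  set Br : Fin (q + 1) → ℝ := fun r => ((2 * (r : ℕ) + 2 : ℕ) : ℝ) ^ m with hBr
  have hA0 : ∀ r, 0 < Ar r := fun r => by simp only [hAr]; positivity
  have hB0 : ∀ r, 0 < Br r := fun r => by simp only [hBr]; positivity
  have hdiv := fun r => trinomial_division (Ar r) (Br r) (hA0 r) (hB0 r) n (by omega)
  choose h₁ h₂ hh₂ hle H hH hid using hdiv
  -- the letters: diagonal coefficients `α r = Ar·Br·h₂`, `β r = −h₁`, top `1`; superdiagonal `1` on letter 0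
  set B : Fin 3 → Matrix (Fin (q + 1)) (Fin (q + 1)) ℝ :=
    ![Matrix.of (fun r c : Fin (q + 1) => if c = r then Ar r * Br r * h₂ r else if (c : ℕ) = r + 1 then (1 : ℝ) else 0),
      Matrix.diagonal (fun r => -h₁ r), (1 : Matrix (Fin (q + 1)) (Fin (q + 1)) ℝ)] with hB
  set δ : ℝ → Fin (q + 1) → ℝ := fun t r => Ar r * Br r * h₂ r * t + -h₁ r * t ^ (1 + m) + t ^ (1 + n * m) with hδ
  have hd1 : (![1, 1 + 2 * (q + 1), 1 + (2 * (q + 1) + 1) * (2 * (q + 1))] : Fin 3 → ℕ) 1 = 1 + m := by simp [hm]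
  have hd2 : (![1, 1 + 2 * (q + 1), 1 + (2 * (q + 1) + 1) * (2 * (q + 1))] : Fin 3 → ℕ) 2 = 1 + n * m := by simp [hm, hn]
  have hBt : ∀ t : ℝ, (∑ l, t ^ (![1, 1 + 2 * (q + 1), 1 + (2 * (q + 1) + 1) * (2 * (q + 1))] : Fin 3 → ℕ) l • B l) =
      Matrix.of (fun r c : Fin (q + 1) => if c = r then δ t r else if (c : ℕ) = r + 1 then t else 0) := by
    intro t
    ext r c
    rw [Matrix.sum_apply, Fin.sum_univ_three, hd1, hd2]
    simp only [hB, hδ, Matrix.smul_apply, Matrix.cons_val_zero, Matrix.cons_val_one, Matrix.head_cons, Matrix.cons_val_two,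
      Matrix.tail_cons, Matrix.of_apply, Matrix.diagonal_apply, Matrix.one_apply, smul_eq_mul]
    by_cases h1 : c = r
    · subst h1; simp; ring
    · have h2 : ¬ r = c := fun h => h1 h.symm
      by_cases h3 : (c : ℕ) = r + 1
      · simp [h1, h2, h3]
      · simp [h1, h2, h3]
  -- factorisation of the diagonal trinomial: `δ t r = t · (u − Ar)(u − Br)·H r u`, `u = t^m`
  have hδfac : ∀ t r, δ t r = t * ((t ^ m - Ar r) * (t ^ m - Br r) * H r (t ^ m)) := by
    intro t r
    have e := hid r (t ^ m)
    have e1 : t ^ (1 + m) = t * t ^ m := by rw [pow_add, pow_one]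
    have e2 : t ^ (1 + n * m) = t * (t ^ m) ^ n := by rw [pow_add, pow_one, mul_comm n m, pow_mul]
    simp only [hδ]
    rw [e1, e2, ← e]
    ring
  have hdet : ∀ t : ℝ, (∑ l, t ^ (![1, 1 + 2 * (q + 1), 1 + (2 * (q + 1) + 1) * (2 * (q + 1))] : Fin 3 → ℕ) l • B l).det =
      ∏ r, δ t r := fun t => by rw [hBt, det_bidiag]
  refine ⟨B, ?_⟩
  obtain ⟨η, hη, h1, h2, h3⟩ := skewBlock_phantoms_square
    (![1, 1 + 2 * (q + 1), 1 + (2 * (q + 1) + 1) * (2 * (q + 1))] : Fin 3 → ℕ) 0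
    (2 * (q + 1) * (1 + (2 * (q + 1) + 1) * (2 * (q + 1))) + 1) B 0 (2 * (q + 1))
    (fun k => (k : ℝ) + 1 / 2) (fun k => (k : ℝ) + 1) (fun k => by simp; norm_num) (fun k => by push_cast; linarith)
    (fun k => by positivity)
    (fun k hk => by
      rw [hdet]
      refine Finset.prod_ne_zero_iff.mpr fun r _ => ?_
      rw [hδfac]
      have hτ : (0 : ℝ) < (k : ℝ) + 1 / 2 := by positivity
      have hτm : (0 : ℝ) ≤ ((k : ℝ) + 1 / 2) ^ m := by positivity
      refine mul_ne_zero hτ.ne' (mul_ne_zero (mul_ne_zero (sub_ne_zero.mpr ?_) (sub_ne_zero.mpr ?_)) (hH r _ hτm).ne')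
      · simp only [hAr]; exact nat_add_half_pow_ne k _ m hm0
      · simp only [hBr]; exact nat_add_half_pow_ne k _ m hm0)
    (fun k hk => by
      rw [hdet]
      refine Finset.prod_eq_zero (Finset.mem_univ (⟨k / 2, by omega⟩ : Fin (q + 1))) ?_
      rw [hδfac]
      rcases Nat.even_or_odd k with ⟨j, hj⟩ | ⟨j, hj⟩
      · have e1 : (k / 2 : ℕ) = j := by omega
        have e2 : ((k : ℝ) + 1) ^ m - Ar ⟨k / 2, by omega⟩ = 0 := by
          simp only [hAr, e1]; push_cast; rw [hj]; push_cast; ring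
        rw [e2]; ring
      · have e1 : (k / 2 : ℕ) = j := by omega
        have e2 : ((k : ℝ) + 1) ^ m - Br ⟨k / 2, by omega⟩ = 0 := by
          simp only [hBr, e1]; push_cast; rw [hj]; push_cast; ring
        rw [e2]; ring)
    (fun k hk => by
      rw [hBt]
      have hinj := mulVec_injective_bidiag_minor (δ ((k : ℝ) + 1)) (show ((k : ℝ) + 1) ≠ 0 by positivity)
      have hpd := Matrix.PosDef.conjTranspose_mul_self _ hinj
      rw [Matrix.conjTranspose_eq_transpose_of_trivial] at hpd
      exact hpd.det_pos.ne')
  have h3' : 4 * (q + 1) ≤ _ := le_of_eq_of_le (by ring) h3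
  refine ⟨η, hη, ?_, ?_, h1, h2, h3'⟩
  · -- the support is an `m`-tower
    rintro ⟨l, hl⟩ ⟨l', hl'⟩ hll'
    rw [Fin.mk_lt_mk] at hll'
    interval_cases l <;> interval_cases l' <;> first | omega | (simp <;> nlinarith)
  · rintro ⟨l, hl⟩
    interval_cases l <;> simp

end BidiagonalTower

end Summit.ValiantsHypothesis.ValiantsHypothesis.Theorems.KPlusLogSqLaw.TowerGraft
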